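/-
Copyright (c) 2026 the pub-hodgecm2 formalisation cell (harness21).  New file.
Origin: seat `prover-pub-hodgecm2-own-b01-g9-0` (unit pub-hodgecm2-own-b01 = owner / drafter / filer of the hM DISCHARGE file, WAKE-hm-discharge
2026-08-22T14:09Z by the stage-2 lead gen 10 under the coordinator's BULK PORT LANE ruling 14:05:33Z; second hand b01-idea-1 gen 51, whose
farm-certified tree half `HOME/b01/IDEA-1aw-Sketch-hM-treehalf.lean` 3dbb3d03308b §(A) is §1 below VERBATIM).  THE hM DISCHARGE FILE
`Summits/HodgeConjecture/CorCM/PortJoin/HMDischarge.lean` (namespace `Summit.HodgeConjecture.CorCM.Model`, so that the `hM` text is the END display's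
:358–:386 BYTE FOR BYTE): §1/§1b–§1d over LANDED tree modules; §2 `hM_of_port` / §3 `hc_cm_of_port_meeting_rec` consume BY NAME the ported head
`HodgeCM.Model.periodThmF_picardCM_of_GRU_thm418C` (`Summits/HodgeConjecture/HodgeCM/Model/PeriodThmFFace.lean` :179, port layer 96; its cone PTF
contains ESM/G12/R34) through PORT JOIN part 2 (`CorCM/PortJoin/PeriodThmF.lean`, item6-p2 row C: the ported model universe IS the tree's, `rfl`).
KERNEL only: theorems; no `def`, no instance, no named fact, no `sorry`; ONE displayed Prop binder in §2 (`h418`, T5 class = `PortJoin/Closed.lean`'s);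
count-neutral until the referees say otherwise; HC_CM is NOT proved; hM is NOT signed equal (HM-EQUALITY) — this file turns «by record» into «by name».
-/
import Summits.HodgeConjecture.HodgeCM.Model.PeriodThmFFace
import Summits.HodgeConjecture.CorCM.PortJoin.PeriodThmF
import Summits.HodgeConjecture.CorCM.B01.Transposition.Item6SupplyPinnedAssemblyAlongHoldsRestOneBuiltEpiD1
import Summits.HodgeConjecture.CorCM.B01.FaceWedgeOverlapMeetingVacuity
import Summits.HodgeConjecture.CorCM.PortJoin.Universe
import Summits.HodgeConjecture.CorCM.Assembly.ModelChain
import Summits.HodgeConjecture.CorCM.Model.CMAbelianVarietyEigenbasisRealisedHolds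
import Literature.NumberTheory.GelbartRogawski1991.CompatibleSplittingCM
import HarnessLib

set_option autoImplicit false

/-!
# hM DISCHARGE BY NAME: the END display's meeting binder `hM` from the PORTED package head

The END display of record (pointer LABEL #7, 2026-08-22T18:33Z) ✔ p335946 `Model.hc_cm_of_thm418AsPrinted_along_conj_holds_restOne_builtEpiD1_meeting_rec`
(`CorCM/B01/Transposition/Item6SupplyPinnedAssemblyAlongHoldsRestOneBuiltEpiD1.lean` :150) consumes at :208 a binder `hM` whose TYPE is
:178–:206 of that file = :358–:386 of its predecessor ✔ p328154 `…RestOneBuiltEpi.lean` (segment md5 `4ad391c4a13e`, byte-identical in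
every display since b01-x2's text).  This file proves that type

* §1  `Model.hM_rec_of_periodThmF_rec` — from `PeriodThmF` of the tree's universe of record `U_rec` (b01-x2's ✔ p301274
  `Model.settingMeetSat_iff_meetCoupling`, direction ←: the ∃-isolation-setting is MANUFACTURED tree-side as the saturating setting over
  `Lp ℂ 2 V.autMeasure`; NO transport of `embOf` / `Perl34.IsolationSetting` / `autMeasure` from the package is consumed);
* §1b `Model.hM_rec_of_pkg_periodThmF` — from `PeriodThmF` of ANY ported-package universe `U : HodgeCM.Universe` identified with `U_rec`
  through PORT JOIN part 1 (✔ p319774 `PortJoin.Universe.ofPkg`, `PortJoin.periodThmF_ofPkg`);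
* §1c `Model.hc_cm_of_pkg_periodThmF_meeting_rec` — the END term of record composed with §1b (display: its four cites + the two port inputs);
* §2  `Model.hM_of_port (h418)` — §1b AT THE PORT: `Upkg := HodgeCM.Model.picardCMUniverse …` (layer 39), `hUpkg := PortJoin.ofPkg_picardCMUniverse
  _ _ _ _` (`rfl`, PORT JOIN part 2), `hP :=` the ported head `HodgeCM.Model.periodThmF_picardCM_of_GRU_thm418C` (layer 96) at the record rows, its
  `hGRU` binder ([GR91 Prop. 3.1.1] in the Π-shape) DISCHARGED by the tree theorem `GRConstruction.gru_shape` (✔ p319353; §E checks the text), its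
  `h418` binder (the READING r8 `Thm418C` of [Liu2021 Thm. 4.18] on the pinned dictionary `HodgeCM.Model.liuDictionaryPin`, layer 67; binder text =
  `PortJoin/Closed.lean` v4 (item6-p2 cc0bed774ef6 :39–:47) VERBATIM) DISPLAYED;
* §3  `Model.hc_cm_of_port_meeting_rec` — the END term of record (pointer #7) at `hM := hM_of_port h418`: display {h418} ∪ {h, hLiu, h21, hD1}.

DOMINATION (numbers, not adjectives): the same input `U_rec.PeriodThmF` gives `HC_CM` through the E term `hc_cm_of_PerLFace` with NONE of the
END display's four cites (§1d); so §3 displays {h, hLiu, h21, hD1} ∪ {h418} ⊋ {h418} = the display of `PortJoin.hc_cm_of_thm418C`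
(PORT JOIN part 3, `CorCM/PortJoin/Closed.lean`).  TRANSPORT TABLE (per head constant of the hM text): `picardCMUniverse` + its four `_holds` rows —
ONE named `rfl` lemma `PortJoin.ofPkg_picardCMUniverse` (4th row by definitional proof irrelevance, §E2); `U.CohC`/`U.pms`/`U.Uiso`/`U.cup2C`,
`Face.psi`/`Face.Admissible`, the code structures — `rfl` through `Universe.ofPkg`/`toPkg`, consumed only inside `PortJoin.periodThmF_ofPkg`;
`embOf` (Δ3), `HermSpace3.autMeasure`, `Lp ℂ 2`, `Perl34.IsolationSetting` (`t12.S12`/`t34.X`/`t34.allowed`/`t34.ϑ`), `⟪·,·⟫_ℂ` — NOT CONSUMED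
(manufactured tree-side by §1); OPEN transports: none.  HC_CM is NOT proved here.
-/

noncomputable section

open scoped TensorProduct InnerProductSpace Kronecker Matrix
open MeasureTheory

namespace Summit.HodgeConjecture.CorCM.Model

open CategoryTheory CategoryTheory.Limits AlgebraicGeometry NumberField
open Literature.AlgebraicGeometry.Motives
open Literature.AlgebraicGeometry.HodgeTheory
open Literature.AlgebraicGeometry.ShimuraVarieties
open Literature.AlgebraicGeometry.ShimuraVarieties.UnitaryCanonicalModel
open Literature.AlgebraicGeometry.ComplexMultiplication (IsCMTypeRealisation)
open Literature.NumberTheory.ComplexMultiplication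
open Literature.NumberTheory.Automorphic
open Literature.NumberTheory.Automorphic.UnitaryGroup (localCharOfCenter)
open Literature.NumberTheory.Automorphic.IdeleClassGroup
open Literature.NumberTheory.Automorphic.PicardCM
open Literature.NumberTheory.Automorphic.Liu2021
open Literature.NumberTheory.Automorphic.Liu2021.AppendixC
open Literature.NumberTheory.Automorphic.Liu2021.AppendixC.RestOne
open Literature.NumberTheory.Automorphic.Liu2021.Def411WeilCarriers (JW TW isSymm_TW isUnit_det_TW JW_eq JW_apply_ne_zero lineOf)
open Literature.NumberTheory.GelbartRogawski1991 Literature.NumberTheory.GelbartRogawski1991.UnitaryDualPair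
open Literature.NumberTheory.GelbartRogawski1991.UnitaryDualPair.WeilCoinv
open Literature.NumberTheory.GelbartRogawski1991.UnitaryDualPair.LocalSplitting (localMu norm_localMu continuous_localMu localMu_toLocalRing_eq_one_iff)
open Literature.NumberTheory.Weil1964 Literature.RepresentationTheory
open Summit.HodgeConjecture.CorCM.Transposition

section HMDischarge

open Prior.Perl34File (Perl34.IsolationSetting)
open Prior.Perl34File.Perl34

/-! ## §1  TREE HALF: `U_rec.PeriodThmF ⟹ hM` -/

/-- **§1 `hM` from `PeriodThmF` of the universe of record** (statement = p335946 :178–:206 = p328154 :358–:386 VERBATIM, the final ` →` dropped): b01-x2's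
`settingMeetSat_iff_meetCoupling` (✔ p301274 :167) direction ←, the right-hand coupling sentence discharged by `hP` itself (its non-vanishing
premiss unused).  No package object occurs. [folklore] -/
theorem hM_rec_of_periodThmF_rec
    (hP : (picardCMUniverse exists_isReal_hodgeModel_holds hodgePQ_independent_of_hodgeModel_holds
      BallQuotient.ballQuotientUniformised_holds cmAbelianVarietyRealised_holds).PeriodThmF) :
    let U := picardCMUniverse exists_isReal_hodgeModel_holds hodgePQ_independent_of_hodgeModel_holds
      BallQuotient.ballQuotientUniformised_holds cmAbelianVarietyRealised_holds
    let hU := ballQuotientUniformisedDatum_of BallQuotient.ballQuotientUniformised_holds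
    (∀ (F : CMField), IsGalois ℚ F → 6 ≤ Module.finrank ℚ F → ∀ (f : Face F) (ι₁ : F →+* ℂ), f.Admissible ι₁ →
      ∀ V : HermSpace3 F ι₁,
      ∃ (H CG G SK SigIdx SigIdxG : Type) (_ : NormedAddCommGroup H) (_ : InnerProductSpace ℂ H) (_ : CompleteSpace H)
        (_ : NormedAddCommGroup CG) (_ : NormedSpace ℂ CG) (_ : Group G) (_ : TopologicalSpace G) (_ : TopologicalSpace SK)
        (S : Perl34.IsolationSetting H (Lp ℂ 2 V.autMeasure) CG G SK SigIdx SigIdxG),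
        (∀ (Γ : Level V) (ω₁ ω₂ : U.CohC (U.pms F ι₁ V Γ) 1),
          ω₁ ∈ U.Uiso Γ F (f.psi 0) ι₁ → ω₂ ∈ U.Uiso Γ F (f.psi 1) ι₁ →
            embOf exists_isReal_hodgeModel_holds hodgePQ_independent_of_hodgeModel_holds hU cmAbelianVarietyRealised_holds Γ
                (U.cup2C (U.pms F ι₁ V Γ) 1 ω₁ ω₂) ≠ 0 →
              ∃ u ∈ S.t12.S12,
                ⟪embOf exists_isReal_hodgeModel_holds hodgePQ_independent_of_hodgeModel_holds hU cmAbelianVarietyRealised_holds Γ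
                    (U.cup2C (U.pms F ι₁ V Γ) 1 ω₁ ω₂), u⟫_ℂ ≠ 0) ∧
        (∀ χ : S.t34.X, S.t34.allowed χ → ∀ (Φ : SK) (Γ₁ : Level V)
          (ω₁ ω₂ : U.CohC (U.pms F ι₁ V Γ₁) 1),
          ω₁ ∈ U.Uiso Γ₁ F (f.psi 0) ι₁ →
          ω₂ ∈ U.Uiso Γ₁ F (f.psi 1) ι₁ →
            ⟪embOf exists_isReal_hodgeModel_holds hodgePQ_independent_of_hodgeModel_holds hU cmAbelianVarietyRealised_holds Γ₁
                (U.cup2C (U.pms F ι₁ V Γ₁) 1 ω₁ ω₂),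
              S.t34.ϑ χ Φ⟫_ℂ ≠ 0 →
              ∃ (Γ : Level V) (ω : Fin 4 → U.CohC (U.pms F ι₁ V Γ) 1),
                (∀ i, ω i ∈ U.Uiso Γ F (f.psi i) ι₁) ∧
                  ⟪embOf exists_isReal_hodgeModel_holds hodgePQ_independent_of_hodgeModel_holds hU cmAbelianVarietyRealised_holds Γ
                      (U.cup2C (U.pms F ι₁ V Γ) 1 (ω 2) (ω 3)),
                    embOf exists_isReal_hodgeModel_holds hodgePQ_independent_of_hodgeModel_holds hU cmAbelianVarietyRealised_holds Γ
                      (U.cup2C (U.pms F ι₁ V Γ) 1 (ω 0) (ω 1))⟫_ℂ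
                    ≠ 0))
    :=
  (settingMeetSat_iff_meetCoupling _ _ _ _).mpr fun F hG h6 f ι₁ hι V _ => hP F hG h6 f ι₁ hι V

/-! ## §1b  PORT JUNCTION: `PeriodThmF` of a ported universe identified with `U_rec` ⟹ `hM` -/

/-- **§1b `hM` from `PeriodThmF` of ANY ported-package universe `U : HodgeCM.Universe` read as `U_rec`** (`hUpkg : Universe.ofPkg Upkg = U_rec`):
§1 after PORT JOIN part 1's transport `PortJoin.periodThmF_ofPkg` (✔ p319774; the code structures `CMField`/`Face`/`HermSpace3`/`Level` are
repackaged field by field, every carrier kept).  The port-gated §2 is this at `U := HodgeCM.Model.picardCMUniverse …` (layer 39),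
`hU := PortJoin.ofPkg_picardCMUniverse _ _ _ _` (PORT JOIN part 2, `rfl`), `hP := HodgeCM.Model.periodThmF_picardCM_of_GRU_thm418C …
GRConstruction.gru_shape h418` (layer 96). [folklore] -/
theorem hM_rec_of_pkg_periodThmF (Upkg : HodgeCM.Universe)
    (hUpkg : PortJoin.Universe.ofPkg Upkg = picardCMUniverse exists_isReal_hodgeModel_holds hodgePQ_independent_of_hodgeModel_holds
      BallQuotient.ballQuotientUniformised_holds cmAbelianVarietyRealised_holds)
    (hP : Upkg.PeriodThmF) :
    let U := picardCMUniverse exists_isReal_hodgeModel_holds hodgePQ_independent_of_hodgeModel_holds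
      BallQuotient.ballQuotientUniformised_holds cmAbelianVarietyRealised_holds
    let hU := ballQuotientUniformisedDatum_of BallQuotient.ballQuotientUniformised_holds
    (∀ (F : CMField), IsGalois ℚ F → 6 ≤ Module.finrank ℚ F → ∀ (f : Face F) (ι₁ : F →+* ℂ), f.Admissible ι₁ →
      ∀ V : HermSpace3 F ι₁,
      ∃ (H CG G SK SigIdx SigIdxG : Type) (_ : NormedAddCommGroup H) (_ : InnerProductSpace ℂ H) (_ : CompleteSpace H)
        (_ : NormedAddCommGroup CG) (_ : NormedSpace ℂ CG) (_ : Group G) (_ : TopologicalSpace G) (_ : TopologicalSpace SK)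
        (S : Perl34.IsolationSetting H (Lp ℂ 2 V.autMeasure) CG G SK SigIdx SigIdxG),
        (∀ (Γ : Level V) (ω₁ ω₂ : U.CohC (U.pms F ι₁ V Γ) 1),
          ω₁ ∈ U.Uiso Γ F (f.psi 0) ι₁ → ω₂ ∈ U.Uiso Γ F (f.psi 1) ι₁ →
            embOf exists_isReal_hodgeModel_holds hodgePQ_independent_of_hodgeModel_holds hU cmAbelianVarietyRealised_holds Γ
                (U.cup2C (U.pms F ι₁ V Γ) 1 ω₁ ω₂) ≠ 0 →
              ∃ u ∈ S.t12.S12,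
                ⟪embOf exists_isReal_hodgeModel_holds hodgePQ_independent_of_hodgeModel_holds hU cmAbelianVarietyRealised_holds Γ
                    (U.cup2C (U.pms F ι₁ V Γ) 1 ω₁ ω₂), u⟫_ℂ ≠ 0) ∧
        (∀ χ : S.t34.X, S.t34.allowed χ → ∀ (Φ : SK) (Γ₁ : Level V)
          (ω₁ ω₂ : U.CohC (U.pms F ι₁ V Γ₁) 1),
          ω₁ ∈ U.Uiso Γ₁ F (f.psi 0) ι₁ →
          ω₂ ∈ U.Uiso Γ₁ F (f.psi 1) ι₁ →
            ⟪embOf exists_isReal_hodgeModel_holds hodgePQ_independent_of_hodgeModel_holds hU cmAbelianVarietyRealised_holds Γ₁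
                (U.cup2C (U.pms F ι₁ V Γ₁) 1 ω₁ ω₂),
              S.t34.ϑ χ Φ⟫_ℂ ≠ 0 →
              ∃ (Γ : Level V) (ω : Fin 4 → U.CohC (U.pms F ι₁ V Γ) 1),
                (∀ i, ω i ∈ U.Uiso Γ F (f.psi i) ι₁) ∧
                  ⟪embOf exists_isReal_hodgeModel_holds hodgePQ_independent_of_hodgeModel_holds hU cmAbelianVarietyRealised_holds Γ
                      (U.cup2C (U.pms F ι₁ V Γ) 1 (ω 2) (ω 3)),
                    embOf exists_isReal_hodgeModel_holds hodgePQ_independent_of_hodgeModel_holds hU cmAbelianVarietyRealised_holds Γ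
                      (U.cup2C (U.pms F ι₁ V Γ) 1 (ω 0) (ω 1))⟫_ℂ
                    ≠ 0))
    :=
  hM_rec_of_periodThmF_rec (hUpkg ▸ PortJoin.periodThmF_ofPkg Upkg hP)

/-! ## §1c  The END term of record composed with §1b -/

/-- **§1c HC_CM from the END display's four cites and `PeriodThmF` of a ported universe read as `U_rec`**: one application of the
END display OF RECORD (pointer LABEL #7) `hc_cm_of_thm418AsPrinted_along_conj_holds_restOne_builtEpiD1_meeting_rec` (✔ p335946 :150; binder
texts :151–:177 VERBATIM) at `hM := §1b`.  Displayed: {`h` [Deligne1979 2.1.2/2.2.5], `hLiu` [Liu2021 Thm. 4.18 as printed at the constructed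
rest], `h21` [Shimura1998 Thm. 21.4], `hD1` [Liu2021 App. D Lem. D.1, first sentence + (1), per place, at the constructed local datum]} + the
port inputs `Upkg`, `hUpkg`, `hP`.  HC_CM is NOT proved: nothing is inhabited here.
[cite: Liu2021, Thm. 4.18 (FJcycle.tex l. 2232–2245), App. D Lem. D.1 (l. 5226–5229)] [cite: Shimura1998, §21.4 Thm. 21.4] [cite: Deligne1979ShimuraVarieties, §2.1.2, 2.2.5 and Cor. 2.7.21] -/
theorem hc_cm_of_pkg_periodThmF_meeting_rec (Upkg : HodgeCM.Universe)
    (hUpkg : PortJoin.Universe.ofPkg Upkg = picardCMUniverse exists_isReal_hodgeModel_holds hodgePQ_independent_of_hodgeModel_holds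
      BallQuotient.ballQuotientUniformised_holds cmAbelianVarietyRealised_holds)
    (hP : Upkg.PeriodThmF)
    (h : exists_recordSystem)
    (hLiu : ∀ (F : CMField) [IsGalois ℚ F] (h6 : 6 ≤ Module.finrank ℚ F) (Φ : CMType F) (ι₁ : F →+* ℂ), ι₁ ∈ Φ.1 →
      ∀ V : HermSpace3 F ι₁, Thm418AsPrintedC (sec42DataOf h isoOf F ι₁ V Φ)
        (restOne (sec42DataOf h isoOf F ι₁ V Φ) (AlgHom.id ℚ F) ι₁ (isConjugateSymplectic_muOfInvType ι₁ Φ) (hasWeight_one_muOfInvType ι₁ Φ) (Def45.Carriers.ofPolDR (muOfInvType ι₁ Φ) (Def45.PolDR ι₁ (isConjugateSymplectic_muOfInvType ι₁ Φ) (Def45.RMuForm ι₁ (isConjugateSymplectic_muOfInvType ι₁ Φ))))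
            (Def411WeilCarriers.Eps ↥(maximalRealSubfield F) (imagUnitSq F)) (Def411WeilCarriers.epsOf ↥(maximalRealSubfield F) (imagUnitSq F) F (imagUnit F)) (Def411WeilCarriers.Chi ↥(maximalRealSubfield F) F (IsCMField.complexConj F))
            (Def411WeilCarriers.omega ↥(maximalRealSubfield F) F (IsCMField.complexConj F) 3 finProdFinEquiv (Matrix.diagonal V.diagEntries) (complexConj_imagUnit F) (imagUnit_ne_zero F) (imagUnit_mul_self F) (realDiagonal_isSymm F V.diagEntries V.complexConj_diagEntries) (isUnit_det_realDiagonal F V.diagEntries V.complexConj_diagEntries V.diagEntries_ne_zero) (realDiagonal_map F V.diagEntries V.complexConj_diagEntries).symm (OmegaMuSplitting.hsMu F ι₁ V Φ))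
            (Def411WeilCarriers.rho ↥(maximalRealSubfield F) F (IsCMField.complexConj F) 3 finProdFinEquiv (Matrix.diagonal V.diagEntries) (complexConj_imagUnit F) (imagUnit_ne_zero F) (imagUnit_mul_self F) (realDiagonal_isSymm F V.diagEntries V.complexConj_diagEntries) (isUnit_det_realDiagonal F V.diagEntries V.complexConj_diagEntries V.diagEntries_ne_zero) (realDiagonal_map F V.diagEntries V.complexConj_diagEntries).symm (OmegaMuSplitting.hsMu F ι₁ V Φ) V.adelicFinDiag.toMulEquiv.toMonoidHom) ((heckeTranslatesFamilyOf heckeTranslate_definedOver_holds h isoOf F ι₁ V Φ h6).rhoΩOne (AlgHom.id ℚ F) ι₁ (isConjugateSymplectic_muOfInvType ι₁ Φ) (hasWeight_one_muOfInvType ι₁ Φ) (Def45.Carriers.ofPolDR (muOfInvType ι₁ Φ) (Def45.PolDR ι₁ (isConjugateSymplectic_muOfInvType ι₁ Φ) (Def45.RMuForm ι₁ (isConjugateSymplectic_muOfInvType ι₁ Φ)))))))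
    (h21 : shimura1998_thm21_4_casselman)
    (hD1 : ∀ (F : CMField) [IsGalois ℚ F], 6 ≤ Module.finrank ℚ F → ∀ (Φ : CMType F) (ι₁ : F →+* ℂ), ι₁ ∈ Φ.1 →
      ∀ (V : HermSpace3 F ι₁) (ε : Def411WeilCarriers.Eps ↥(maximalRealSubfield F) (imagUnitSq F))
        (χ : Def411WeilCarriers.Chi ↥(maximalRealSubfield F) F (IsCMField.complexConj F)) (v : IsDedekindDomain.HeightOneSpectrum (𝓞 ↥(maximalRealSubfield F))),
        LemD1_1AsPrinted
          (Def411WeilCarriers.localLemD1Data ↥(maximalRealSubfield F) F (IsCMField.complexConj F) 3 finProdFinEquiv (Matrix.diagonal V.diagEntries)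
            (complexConj_imagUnit F) (imagUnit_ne_zero F) (imagUnit_mul_self F) (realDiagonal_isSymm F V.diagEntries V.complexConj_diagEntries)
            (isUnit_det_realDiagonal F V.diagEntries V.complexConj_diagEntries V.diagEntries_ne_zero)
            (realDiagonal_map F V.diagEntries V.complexConj_diagEntries).symm (lineOf ↥(maximalRealSubfield F) (imagUnitSq F) ε)
            (OmegaMuSplitting.muLocalSplittings F ι₁ V Φ (lineOf ↥(maximalRealSubfield F) (imagUnitSq F) ε))
            (le_of_eq (Nat.mul_one 3).symm) (localMu F (OmegaMuSplitting.chiMu F ι₁ Φ))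
            (fun v x => norm_localMu F (OmegaMuSplitting.chiMu F ι₁ Φ) v (OmegaMuSplitting.chiMu_isUnitary F ι₁ Φ) x)
            (continuous_localMu F (OmegaMuSplitting.chiMu F ι₁ Φ))
            (fun v t => localMu_toLocalRing_eq_one_iff F (OmegaMuSplitting.chiMu F ι₁ Φ) v (OmegaMuSplitting.chiMu_isSplittingChar F ι₁ Φ) t)
            χ.1
            (Def411WeilCarriers.norm_chi_eq_one ↥(maximalRealSubfield F) F (IsCMField.complexConj F)
              (Algebra.IsQuadraticExtension.finrank_eq_two ↥(maximalRealSubfield F) F)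
              (UnitaryGroup.algEquiv_ne_one_of_apply_eq_neg ↥(maximalRealSubfield F) F (IsCMField.complexConj F) (complexConj_imagUnit F)
                (imagUnit_ne_zero F)) χ)
            χ.2.1 v)) :
    HC_CM :=
  hc_cm_of_thm418AsPrinted_along_conj_holds_restOne_builtEpiD1_meeting_rec h hLiu h21 hD1 (hM_rec_of_pkg_periodThmF Upkg hUpkg hP)

/-! ## §1d  DOMINATION: the same port input gives HC_CM through the E term, with none of the four cites -/

/-- **§1d** `PeriodThmF` of a ported universe read as `U_rec` ⟹ `HC_CM` through the E term of record `hc_cm_of_PerLFace`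
(`Assembly/ModelChain.lean`) and [DeligneMilne1982 Thm. 6.20] proved (`deligneMilne1982_Thm_6_20_full_holds`) — NO cite of the END display is used.
[cite: DeligneMilne1982Tannakian, §6 Thm. 6.20 (Riemann), p. 212] -/
theorem hc_cm_of_pkg_periodThmF_via_E (Upkg : HodgeCM.Universe)
    (hUpkg : PortJoin.Universe.ofPkg Upkg = picardCMUniverse exists_isReal_hodgeModel_holds hodgePQ_independent_of_hodgeModel_holds
      BallQuotient.ballQuotientUniformised_holds cmAbelianVarietyRealised_holds)
    (hP : Upkg.PeriodThmF) : HC_CM :=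
  hc_cm_of_PerLFace _ _ _ _ (hUpkg ▸ PortJoin.periodThmF_ofPkg Upkg hP) deligneMilne1982_Thm_6_20_full_holds

/-! ## §2  AT THE PORT: `hM` BY NAME from the ported package head -/

/-- **§2 `hM` BY NAME** — the END display's theta-side meeting binder `hM` (✔ p328154 :358–:386 VERBATIM incl. its two `let`s) from the PORTED
package head `HodgeCM.Model.periodThmF_picardCM_of_GRU_thm418C` (`Summits/HodgeConjecture/HodgeCM/Model/PeriodThmFFace.lean` :179 = package
`Model/PeriodThmFFace.lean` :176 of HodgeCMPerL run 82; its cone contains `Model/EndStateMeet.lean` :353, `Model/Binders/Gen12PinsROGT2Ge.lean` :114,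
`Model/Binders/Real34PinsROGT2S.lean` :84, which it consumes internally) through §1b at PORT JOIN part 2's `PortJoin.ofPkg_picardCMUniverse` (`rfl`).
[GR91 Prop. 3.1.1] is the tree theorem `GRConstruction.gru_shape`; the ONE displayed hypothesis is `h418` = the combined READING r8 `Thm418C` of
[Liu2021 Thm. 4.18] on the pinned dictionary (binder text = `PortJoin/Closed.lean` v4 (item6-p2 cc0bed774ef6 :39–:47) VERBATIM) — NOT «Thm. 4.18 as printed».  `hM` is here a
CONSEQUENCE of `PerLFace U_rec` (§1), not a proof of it.  HC_CM is NOT proved.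
[cite: Liu2021, Thm. 4.18 (FJcycle.tex l. 2232–2245)] [cite: GelbartRogawski1991, §3.1 Prop. 3.1.1 p. 455 L1–3] -/
theorem hM_of_port
    (h418 : ∀ {L : HodgeCM.CMField} {ι₁ : L →+* ℂ} (V : HodgeCM.HermSpace3 L ι₁),
      (NumberField.InfinitePlace.mk ι₁).embedding = ι₁ → ∀ a₀ : HodgeCM.Model.LiuIndex.RealScalar L,
      (HodgeCM.Model.liuDictionaryPin exists_isReal_hodgeModel_holds hodgePQ_independent_of_hodgeModel_holds
          BallQuotient.ballQuotientUniformised_holds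
          (cmAbelianVarietyRealised_of_eigenbasis exists_isReal_hodgeModel_holds hodgePQ_independent_of_hodgeModel_holds
            cmAbelianVarietyEigenbasisRealised_holds)
          Literature.NumberTheory.Transcendental.arapura2012_cor_15_4_6_holds V
          (HodgeCM.Model.LiuIndex.I V (HodgeCM.Model.LiuIndex.repAt a₀) (HodgeCM.Model.LiuIndex.muLiu ι₁ HodgeCM.Model.LiuIndex.GramClass.rep))
          (HodgeCM.Model.LiuIndex.line V (HodgeCM.Model.LiuIndex.repAt a₀) (HodgeCM.Model.LiuIndex.muLiu ι₁ HodgeCM.Model.LiuIndex.GramClass.rep))).Thm418C) :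
    let U := picardCMUniverse exists_isReal_hodgeModel_holds hodgePQ_independent_of_hodgeModel_holds
      BallQuotient.ballQuotientUniformised_holds cmAbelianVarietyRealised_holds
    let hU := ballQuotientUniformisedDatum_of BallQuotient.ballQuotientUniformised_holds
    (∀ (F : CMField), IsGalois ℚ F → 6 ≤ Module.finrank ℚ F → ∀ (f : Face F) (ι₁ : F →+* ℂ), f.Admissible ι₁ →
      ∀ V : HermSpace3 F ι₁,
      ∃ (H CG G SK SigIdx SigIdxG : Type) (_ : NormedAddCommGroup H) (_ : InnerProductSpace ℂ H) (_ : CompleteSpace H)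
        (_ : NormedAddCommGroup CG) (_ : NormedSpace ℂ CG) (_ : Group G) (_ : TopologicalSpace G) (_ : TopologicalSpace SK)
        (S : Perl34.IsolationSetting H (Lp ℂ 2 V.autMeasure) CG G SK SigIdx SigIdxG),
        (∀ (Γ : Level V) (ω₁ ω₂ : U.CohC (U.pms F ι₁ V Γ) 1),
          ω₁ ∈ U.Uiso Γ F (f.psi 0) ι₁ → ω₂ ∈ U.Uiso Γ F (f.psi 1) ι₁ →
            embOf exists_isReal_hodgeModel_holds hodgePQ_independent_of_hodgeModel_holds hU cmAbelianVarietyRealised_holds Γ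
                (U.cup2C (U.pms F ι₁ V Γ) 1 ω₁ ω₂) ≠ 0 →
              ∃ u ∈ S.t12.S12,
                ⟪embOf exists_isReal_hodgeModel_holds hodgePQ_independent_of_hodgeModel_holds hU cmAbelianVarietyRealised_holds Γ
                    (U.cup2C (U.pms F ι₁ V Γ) 1 ω₁ ω₂), u⟫_ℂ ≠ 0) ∧
        (∀ χ : S.t34.X, S.t34.allowed χ → ∀ (Φ : SK) (Γ₁ : Level V)
          (ω₁ ω₂ : U.CohC (U.pms F ι₁ V Γ₁) 1),
          ω₁ ∈ U.Uiso Γ₁ F (f.psi 0) ι₁ →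
          ω₂ ∈ U.Uiso Γ₁ F (f.psi 1) ι₁ →
            ⟪embOf exists_isReal_hodgeModel_holds hodgePQ_independent_of_hodgeModel_holds hU cmAbelianVarietyRealised_holds Γ₁
                (U.cup2C (U.pms F ι₁ V Γ₁) 1 ω₁ ω₂),
              S.t34.ϑ χ Φ⟫_ℂ ≠ 0 →
              ∃ (Γ : Level V) (ω : Fin 4 → U.CohC (U.pms F ι₁ V Γ) 1),
                (∀ i, ω i ∈ U.Uiso Γ F (f.psi i) ι₁) ∧
                  ⟪embOf exists_isReal_hodgeModel_holds hodgePQ_independent_of_hodgeModel_holds hU cmAbelianVarietyRealised_holds Γ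
                      (U.cup2C (U.pms F ι₁ V Γ) 1 (ω 2) (ω 3)),
                    embOf exists_isReal_hodgeModel_holds hodgePQ_independent_of_hodgeModel_holds hU cmAbelianVarietyRealised_holds Γ
                      (U.cup2C (U.pms F ι₁ V Γ) 1 (ω 0) (ω 1))⟫_ℂ
                    ≠ 0))
    :=
  hM_rec_of_pkg_periodThmF _ (PortJoin.ofPkg_picardCMUniverse _ _ _ _)
    (HodgeCM.Model.periodThmF_picardCM_of_GRU_thm418C exists_isReal_hodgeModel_holds hodgePQ_independent_of_hodgeModel_holds
      BallQuotient.ballQuotientUniformised_holds cmAbelianVarietyEigenbasisRealised_holds GRConstruction.gru_shape h418)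

/-! ## §3  The END term of record at `hM := hM_of_port h418` -/

/-- **§3 HC_CM from the port's `h418` and the END display's four cites** {`h` [Deligne1979 2.1.2/2.2.5], `hLiu` [Liu2021 Thm. 4.18 as printed at
the constructed rest], `h21` [Shimura1998 Thm. 21.4], `hD1` [Liu2021 App. D Lem. D.1, per place]} (binder texts = ✔ p335946 :151–:177 VERBATIM,
pointer LABEL #7): one application of `hc_cm_of_thm418AsPrinted_along_conj_holds_restOne_builtEpiD1_meeting_rec` at `hM := hM_of_port h418`.  Five displayed
hypotheses ⊋ the one of `PortJoin.hc_cm_of_thm418C` (§1d: domination).  HC_CM is NOT proved: nothing is inhabited here.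
[cite: Liu2021, Thm. 4.18 (FJcycle.tex l. 2232–2245)] [cite: Shimura1998, §21.4 Thm. 21.4] [cite: Deligne1979ShimuraVarieties, §2.1.2, 2.2.5 and Cor. 2.7.21] -/
theorem hc_cm_of_port_meeting_rec
    (h418 : ∀ {L : HodgeCM.CMField} {ι₁ : L →+* ℂ} (V : HodgeCM.HermSpace3 L ι₁),
      (NumberField.InfinitePlace.mk ι₁).embedding = ι₁ → ∀ a₀ : HodgeCM.Model.LiuIndex.RealScalar L,
      (HodgeCM.Model.liuDictionaryPin exists_isReal_hodgeModel_holds hodgePQ_independent_of_hodgeModel_holds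
          BallQuotient.ballQuotientUniformised_holds
          (cmAbelianVarietyRealised_of_eigenbasis exists_isReal_hodgeModel_holds hodgePQ_independent_of_hodgeModel_holds
            cmAbelianVarietyEigenbasisRealised_holds)
          Literature.NumberTheory.Transcendental.arapura2012_cor_15_4_6_holds V
          (HodgeCM.Model.LiuIndex.I V (HodgeCM.Model.LiuIndex.repAt a₀) (HodgeCM.Model.LiuIndex.muLiu ι₁ HodgeCM.Model.LiuIndex.GramClass.rep))
          (HodgeCM.Model.LiuIndex.line V (HodgeCM.Model.LiuIndex.repAt a₀) (HodgeCM.Model.LiuIndex.muLiu ι₁ HodgeCM.Model.LiuIndex.GramClass.rep))).Thm418C)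
    (h : exists_recordSystem)
    (hLiu : ∀ (F : CMField) [IsGalois ℚ F] (h6 : 6 ≤ Module.finrank ℚ F) (Φ : CMType F) (ι₁ : F →+* ℂ), ι₁ ∈ Φ.1 →
      ∀ V : HermSpace3 F ι₁, Thm418AsPrintedC (sec42DataOf h isoOf F ι₁ V Φ)
        (restOne (sec42DataOf h isoOf F ι₁ V Φ) (AlgHom.id ℚ F) ι₁ (isConjugateSymplectic_muOfInvType ι₁ Φ) (hasWeight_one_muOfInvType ι₁ Φ) (Def45.Carriers.ofPolDR (muOfInvType ι₁ Φ) (Def45.PolDR ι₁ (isConjugateSymplectic_muOfInvType ι₁ Φ) (Def45.RMuForm ι₁ (isConjugateSymplectic_muOfInvType ι₁ Φ))))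
            (Def411WeilCarriers.Eps ↥(maximalRealSubfield F) (imagUnitSq F)) (Def411WeilCarriers.epsOf ↥(maximalRealSubfield F) (imagUnitSq F) F (imagUnit F)) (Def411WeilCarriers.Chi ↥(maximalRealSubfield F) F (IsCMField.complexConj F))
            (Def411WeilCarriers.omega ↥(maximalRealSubfield F) F (IsCMField.complexConj F) 3 finProdFinEquiv (Matrix.diagonal V.diagEntries) (complexConj_imagUnit F) (imagUnit_ne_zero F) (imagUnit_mul_self F) (realDiagonal_isSymm F V.diagEntries V.complexConj_diagEntries) (isUnit_det_realDiagonal F V.diagEntries V.complexConj_diagEntries V.diagEntries_ne_zero) (realDiagonal_map F V.diagEntries V.complexConj_diagEntries).symm (OmegaMuSplitting.hsMu F ι₁ V Φ))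
            (Def411WeilCarriers.rho ↥(maximalRealSubfield F) F (IsCMField.complexConj F) 3 finProdFinEquiv (Matrix.diagonal V.diagEntries) (complexConj_imagUnit F) (imagUnit_ne_zero F) (imagUnit_mul_self F) (realDiagonal_isSymm F V.diagEntries V.complexConj_diagEntries) (isUnit_det_realDiagonal F V.diagEntries V.complexConj_diagEntries V.diagEntries_ne_zero) (realDiagonal_map F V.diagEntries V.complexConj_diagEntries).symm (OmegaMuSplitting.hsMu F ι₁ V Φ) V.adelicFinDiag.toMulEquiv.toMonoidHom) ((heckeTranslatesFamilyOf heckeTranslate_definedOver_holds h isoOf F ι₁ V Φ h6).rhoΩOne (AlgHom.id ℚ F) ι₁ (isConjugateSymplectic_muOfInvType ι₁ Φ) (hasWeight_one_muOfInvType ι₁ Φ) (Def45.Carriers.ofPolDR (muOfInvType ι₁ Φ) (Def45.PolDR ι₁ (isConjugateSymplectic_muOfInvType ι₁ Φ) (Def45.RMuForm ι₁ (isConjugateSymplectic_muOfInvType ι₁ Φ)))))))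
    (h21 : shimura1998_thm21_4_casselman)
    (hD1 : ∀ (F : CMField) [IsGalois ℚ F], 6 ≤ Module.finrank ℚ F → ∀ (Φ : CMType F) (ι₁ : F →+* ℂ), ι₁ ∈ Φ.1 →
      ∀ (V : HermSpace3 F ι₁) (ε : Def411WeilCarriers.Eps ↥(maximalRealSubfield F) (imagUnitSq F))
        (χ : Def411WeilCarriers.Chi ↥(maximalRealSubfield F) F (IsCMField.complexConj F)) (v : IsDedekindDomain.HeightOneSpectrum (𝓞 ↥(maximalRealSubfield F))),
        LemD1_1AsPrinted
          (Def411WeilCarriers.localLemD1Data ↥(maximalRealSubfield F) F (IsCMField.complexConj F) 3 finProdFinEquiv (Matrix.diagonal V.diagEntries)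
            (complexConj_imagUnit F) (imagUnit_ne_zero F) (imagUnit_mul_self F) (realDiagonal_isSymm F V.diagEntries V.complexConj_diagEntries)
            (isUnit_det_realDiagonal F V.diagEntries V.complexConj_diagEntries V.diagEntries_ne_zero)
            (realDiagonal_map F V.diagEntries V.complexConj_diagEntries).symm (lineOf ↥(maximalRealSubfield F) (imagUnitSq F) ε)
            (OmegaMuSplitting.muLocalSplittings F ι₁ V Φ (lineOf ↥(maximalRealSubfield F) (imagUnitSq F) ε))
            (le_of_eq (Nat.mul_one 3).symm) (localMu F (OmegaMuSplitting.chiMu F ι₁ Φ))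
            (fun v x => norm_localMu F (OmegaMuSplitting.chiMu F ι₁ Φ) v (OmegaMuSplitting.chiMu_isUnitary F ι₁ Φ) x)
            (continuous_localMu F (OmegaMuSplitting.chiMu F ι₁ Φ))
            (fun v t => localMu_toLocalRing_eq_one_iff F (OmegaMuSplitting.chiMu F ι₁ Φ) v (OmegaMuSplitting.chiMu_isSplittingChar F ι₁ Φ) t)
            χ.1
            (Def411WeilCarriers.norm_chi_eq_one ↥(maximalRealSubfield F) F (IsCMField.complexConj F)
              (Algebra.IsQuadraticExtension.finrank_eq_two ↥(maximalRealSubfield F) F)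
              (UnitaryGroup.algEquiv_ne_one_of_apply_eq_neg ↥(maximalRealSubfield F) F (IsCMField.complexConj F) (complexConj_imagUnit F)
                (imagUnit_ne_zero F)) χ)
            χ.2.1 v)) :
    HC_CM :=
  hc_cm_of_thm418AsPrinted_along_conj_holds_restOne_builtEpiD1_meeting_rec h hLiu h21 hD1 (hM_of_port h418)

/-! ## §E  Shape checks (examples, no declarations) -/

/-- (E1) the ported head's `hGRU` binder text (`HodgeCM/Model/PeriodThmFFace.lean` :180–:183, over the SHARED Literature constant
`UnitaryDualPair.cmSplittingDatum`) is inhabited VERBATIM by the tree theorem `GRConstruction.gru_shape` (✔ p319353). -/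
example :
    ∀ (L : Type) [Field L] [NumberField L] [NumberField.IsCMField L] {N M n : ℕ} (e : Fin N × Fin M ≃ Fin n)
      (dV : Fin N → L) (hdV : ∀ i, NumberField.IsCMField.complexConj L (dV i) = dV i) (hdV0 : ∀ i, dV i ≠ 0)
      (dW : Fin M → L) (hdW : ∀ i, NumberField.IsCMField.complexConj L (dW i) = dW i) (hdW0 : ∀ i, dW i ≠ 0),
      (cmSplittingDatum L e dV hdV hdV0 dW hdW hdW0).CompatibleSplitting :=
  GRConstruction.gru_shape

/-- (E2) §1b ACCEPTS an identification stated at the ported head's fourth row `cmAbelianVarietyRealised_of_eigenbasis hHD hI h♭`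
(the shape of PORT JOIN part 2's `ofPkg_picardCMUniverse _ _ _ _` at the head's rows): definitional proof irrelevance on the `Prop` row. -/
example (Upkg : HodgeCM.Universe)
    (hUpkg : PortJoin.Universe.ofPkg Upkg = picardCMUniverse exists_isReal_hodgeModel_holds hodgePQ_independent_of_hodgeModel_holds
      BallQuotient.ballQuotientUniformised_holds
      (cmAbelianVarietyRealised_of_eigenbasis exists_isReal_hodgeModel_holds hodgePQ_independent_of_hodgeModel_holds
        cmAbelianVarietyEigenbasisRealised_holds))
    (hP : Upkg.PeriodThmF) :=
  hM_rec_of_pkg_periodThmF Upkg hUpkg hP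

end HMDischarge

end Summit.HodgeConjecture.CorCM.Model

end
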